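import Mathlib
import HarnessLib
import Summits.HubbardSuperconductivity.HubbardSuperconductivity.Theorems.KLProgrammeCutCurrencyAllStrings

/-!
# Route `KLProgramme` — ENGINE (stmt-HubbardSuperconductivity-20437 `KLRegimeEngineV17F2`), located #25 cure (α): the UNWEIGHTED cut plain currency of the bare
# vertex at EVERY label string, `ε_x³ Σ_{x′ : x′_q = y} ‖W₄(S_ĝ V)(τ′; x′)‖ ≤ (|U|/24)·8⁴`, uniformly in `128 ≤ β ≤ M`
(cell gate-hubbard-kl; visitor seat leafhand-hubbard-klprogramme-3 g0; helper `--supports stmt-HubbardSuperconductivity-20437`; completes ✓ `…CutCurrencyLegMassEight`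
(`klbv_plainCurrency_uvCut_hubbardInteraction_le_sharp`, vertex pattern only) to all strings exactly as ✓ `…CutCurrencyAllStrings` completes `…CutCurrencyScaleWt`)

The moment-order-`0` cut plain quartic line of binder #2 (row (C), `cN m 0`: weight `(spatial distance)^0 = 1`, strings
`![((0,σ),0), ((0,σ),1), ((0,s),1−c), ((0,s),c)]`, pinned at leg `0`) and any other UNWEIGHTED cut plain quartic row read the bare vertex `V` at arbitrary
label strings `τ′ : Fin 4 → SectorLeg 1`.  As in `…CutCurrencyAllStrings`: a repeated `(spin, charge)` type kills `W₄^c(V)(τ′, ·)`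
(`klbv_sectorisedKernel_freqMul_eq_zero_of_type_eq`); otherwise `τ′` is a signed permutation `σ` of the vertex pattern
(`klbv_sectorisedKernel_freqMul_eq_perm`) and the pinned sum over `x′_q = y` is the pattern's pinned sum over `x′_{σ q} = y` (`klbv_sum_pinned_comp_perm`),
bounded by ✓ `klbv_plainCurrency_uvCut_hubbardInteraction_le_sharp`.  Result: **`klbv_plainCurrency_uvCut_hubbardInteraction_le_sharp_allStrings`** — the bare-vertex
datum for splitting ANY unweighted UV-cut plain quartic row along `G = V + (G − V)` (`EngineV8.A24a1G14.klbv_wtPinnedSum_norm_sectorisedKernel_le_add` with weight `1`).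
No definition; nothing asserts any row, (b), (C), K3, U₀, the window or superconductivity.  References: BGM 2006 §2.1 (2.6a), §2.3 [cite: BenfattoGiulianiMastropietro2006].
-/

noncomputable section

namespace Summit.HubbardSuperconductivity.HubbardSuperconductivity.Theorems.KLRegimeSplit

set_option linter.dupNamespace false -- summit = problem name (single-conjunct summit), D-0017

open Finset Literature.MathematicalPhysics.QuantumLattice Literature.Probability.LatticeModels GrassmannAlgebra
open Summit.HubbardSuperconductivity.HubbardSuperconductivity.Theorems.EngineV8
open Summit.HubbardSuperconductivity.HubbardSuperconductivity.Theorems.KLProgrammeLegKernels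
open Summit.HubbardSuperconductivity.HubbardSuperconductivity.Theorems.C4a

variable {L M : ℕ} [NeZero L] [NeZero M]

/-- **THE UNWEIGHTED CUT PLAIN CURRENCY OF THE BARE VERTEX AT EVERY LABEL STRING, UNIFORMLY** (`128 ≤ β ≤ M`; every `L`, `U`, `τ′ : Fin 4 → SectorLeg 1`,
pinned leg `q`, pin `y`): `ε_x³ Σ_{x′ : x′_q = y} ‖W₄(S_ĝ V)(τ′; x′)‖ ≤ (|U|/24)·8⁴` — degenerate strings give `0`, non-degenerate strings are signed permutations
of the vertex pattern (pin moved to `σ q`), where ✓ `klbv_plainCurrency_uvCut_hubbardInteraction_le_sharp` applies. [cite: BenfattoGiulianiMastropietro2006, §2.1 (2.6a)] -/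
theorem klbv_plainCurrency_uvCut_hubbardInteraction_le_sharp_allStrings {β : ℝ} (hβ : 128 ≤ β) (hM : β ≤ M) (U : ℝ)
    (τ' : Fin 4 → SectorLeg 1) (q : Fin 4) (y : SpaceTimeIdx L M) :
    imagTimeWeight β M ^ 3 *
        ∑ x ∈ univ.filter (fun x : Fin 4 → SpaceTimeIdx L M => x q = y),
          ‖sectorisedKernel L M β (trivialMultiplier L M)
            (ExteriorAlgebra.map (LinearMap.mulLeft ℂ (fun K : HubbardFieldIdx L M => ((gnScaleCutoff 4 klE0 1 |matsubaraFreq β M K.1.1.1| : ℝ) : ℂ))) (hubbardInteraction L M β U)) 4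
            τ' x‖ ≤
      |U| / 24 * 8 ^ 4 := by
  classical
  have hRHS : 0 ≤ |U| / 24 * (8 : ℝ) ^ 4 := by positivity
  -- the cut vertex's plain kernels are the `ĝ`-weighted kernels of `V` (any string)
  have hbridge : ∀ (Ω : Fin 4 → SectorLeg 1) (x : Fin 4 → SpaceTimeIdx L M),
      sectorisedKernel L M β (trivialMultiplier L M)
          (ExteriorAlgebra.map (LinearMap.mulLeft ℂ (fun K : HubbardFieldIdx L M => ((gnScaleCutoff 4 klE0 1 |matsubaraFreq β M K.1.1.1| : ℝ) : ℂ))) (hubbardInteraction L M β U)) 4 Ω x =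
        sectorisedKernel L M β (fun (_ : Fin 1) (k : FreqMomentum L M) => (((gnScaleCutoff 4 klE0 1 |matsubaraFreq β M k.1| : ℝ) : ℂ))) (hubbardInteraction L M β U) 4 Ω x :=
    fun Ω x => klbv_sectorisedKernel_uvCut_hubbardInteraction_eq β U 4 Ω x
  by_cases hτ : ∀ i i' : Fin 4, (τ' i).1.2 = (τ' i').1.2 → (τ' i).2 = (τ' i').2 → i = i'
  · -- non-degenerate: a signed permutation of the pattern
    obtain ⟨σ, hσ⟩ := klbv_sectorisedKernel_freqMul_eq_perm (L := L) β U (fun i : MatsubaraIdx M => (((gnScaleCutoff 4 klE0 1 |matsubaraFreq β M i| : ℝ) : ℂ))) τ' hτ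
    have hsign : ‖((Equiv.Perm.sign σ : ℤˣ) : ℂ)‖ = 1 := by
      rcases Int.units_eq_one_or (Equiv.Perm.sign σ) with h | h <;> simp [h]
    have hterm : ∀ x : Fin 4 → SpaceTimeIdx L M,
        ‖sectorisedKernel L M β (trivialMultiplier L M)
            (ExteriorAlgebra.map (LinearMap.mulLeft ℂ (fun K : HubbardFieldIdx L M => ((gnScaleCutoff 4 klE0 1 |matsubaraFreq β M K.1.1.1| : ℝ) : ℂ))) (hubbardInteraction L M β U)) 4 τ' x‖ =
        (fun x' : Fin 4 → SpaceTimeIdx L M =>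
          ‖sectorisedKernel L M β (trivialMultiplier L M)
            (ExteriorAlgebra.map (LinearMap.mulLeft ℂ (fun K : HubbardFieldIdx L M => ((gnScaleCutoff 4 klE0 1 |matsubaraFreq β M K.1.1.1| : ℝ) : ℂ))) (hubbardInteraction L M β U)) 4
            (![(((0 : Fin 1), (0 : Fin 2)), (0 : Fin 2)), ((0, 0), 1), ((0, 1), 0), ((0, 1), 1)] : Fin 4 → SectorLeg 1) x'‖) (x ∘ σ.symm) := by
      intro x
      simp only []
      rw [hbridge, hbridge, hσ x, norm_mul, hsign, one_mul]
    rw [Finset.sum_congr rfl (fun x _ => hterm x), klbv_sum_pinned_comp_perm (fun x' : Fin 4 → SpaceTimeIdx L M =>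
          ‖sectorisedKernel L M β (trivialMultiplier L M)
            (ExteriorAlgebra.map (LinearMap.mulLeft ℂ (fun K : HubbardFieldIdx L M => ((gnScaleCutoff 4 klE0 1 |matsubaraFreq β M K.1.1.1| : ℝ) : ℂ))) (hubbardInteraction L M β U)) 4
            (![(((0 : Fin 1), (0 : Fin 2)), (0 : Fin 2)), ((0, 0), 1), ((0, 1), 0), ((0, 1), 1)] : Fin 4 → SectorLeg 1) x'‖) σ q y]
    exact klbv_plainCurrency_uvCut_hubbardInteraction_le_sharp hβ hM U (σ q) y
  · -- degenerate string: the kernel vanishes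
    push Not at hτ
    obtain ⟨i, i', hs, hc, hii'⟩ := hτ
    have h0 : ∀ x : Fin 4 → SpaceTimeIdx L M, sectorisedKernel L M β (trivialMultiplier L M)
        (ExteriorAlgebra.map (LinearMap.mulLeft ℂ (fun K : HubbardFieldIdx L M => ((gnScaleCutoff 4 klE0 1 |matsubaraFreq β M K.1.1.1| : ℝ) : ℂ))) (hubbardInteraction L M β U)) 4 τ' x = 0 := by
      intro x
      rw [hbridge]
      exact klbv_sectorisedKernel_freqMul_eq_zero_of_type_eq β U (fun i : MatsubaraIdx M => (((gnScaleCutoff 4 klE0 1 |matsubaraFreq β M i| : ℝ) : ℂ))) τ' hii' hs hc x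
    rw [Finset.sum_eq_zero (fun x _ => by rw [h0 x, norm_zero]), mul_zero]
    exact hRHS

/-- **The same at the route's threshold `klBetaMin = 128`**: for `klBetaMin ≤ β ≤ M`. [cite: BenfattoGiulianiMastropietro2006, §2.1 (2.6a)] -/
theorem klbv_plainCurrency_uvCut_hubbardInteraction_le_sharp_allStrings' {β : ℝ} (hβ : klBetaMin ≤ β) (hM : β ≤ M) (U : ℝ)
    (τ' : Fin 4 → SectorLeg 1) (q : Fin 4) (y : SpaceTimeIdx L M) :
    imagTimeWeight β M ^ 3 *
        ∑ x ∈ univ.filter (fun x : Fin 4 → SpaceTimeIdx L M => x q = y),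
          ‖sectorisedKernel L M β (trivialMultiplier L M)
            (ExteriorAlgebra.map (LinearMap.mulLeft ℂ (fun K : HubbardFieldIdx L M => ((gnScaleCutoff 4 klE0 1 |matsubaraFreq β M K.1.1.1| : ℝ) : ℂ))) (hubbardInteraction L M β U)) 4
            τ' x‖ ≤
      |U| / 24 * 8 ^ 4 :=
  klbv_plainCurrency_uvCut_hubbardInteraction_le_sharp_allStrings (le_trans (by norm_num [klBetaMin]) hβ) hM U τ' q y

end Summit.HubbardSuperconductivity.HubbardSuperconductivity.Theorems.KLRegimeSplit

end
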